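import Mathlib
import Summits.QuantumFields.YangMills.Theorems.TransportFieldFanoTorelonFloor
import Summits.QuantumFields.YangMills.Theorems.CovariantCurrentDoorCurrentNormFloorStubDirectionSymmetry
import HarnessLib

/-!
# The torelon floor in the letters of the lines: `⟨F₀Ω, Ω⟩ ≥ e^{−15}/β²` and `⟨F₁Ω, Ω⟩ ≥ e^{−15}/β²` (both spatial directions)
# (routes `TransportFieldFano` / `CovariantCurrentDoor`, LINES g17-A/B; helper lane — the LOWER counterpart of `MeanLoopCeilingWeak` ⟨23353⟩ and
# the positivity conjunct `0 < ⟨F₁Ω, Ω⟩` of `stub_crossCoherenceFloor` ⟨23380⟩)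

Corollaries of ★★★ `torelonDev_vacuum_mean_ge` (✓`…TransportFieldFanoTorelonFloor`: `∫ d_x·Ω² ≥ e^{−15}/β²`): translation invariance of the vacuum
(✓`l2_flowLiftAt_mul_vacuum_eq_flowLift`) turns the single-site floor into the site-averaged letter `F₀ = flowLift 0 (4 − (Re tr u(0,0))²)` used by every
item of LINES g17-A/B, and the axis symmetry ✓`CovariantCurrentDoor.stub_directionSymmetry` (`⟨F₀Ω,Ω⟩ = ⟨F₁Ω,Ω⟩`) carries it to direction `1`:
* ★ `torelonMean_zero_ge` — `e^{−15}/β² ≤ ⟨F₀Ω, Ω⟩`, ★ `torelonMean_one_ge` — `e^{−15}/β² ≤ ⟨F₁Ω, Ω⟩` (`β ≥ 1`, every `L`, every `l2`-normalised physical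
  `Ω` with `K_βΩ = λ₀Ω`); `torelonMean_zero_pos`, `torelonMean_one_pos` — the strict positivity conjuncts.
So in the window letters of the lines the torelon means are squeezed between `e^{−15}β^{−2}` (this file, unconditional) and the OPEN ceilings `C·L^k·β^{−1/2}`
(⟨23353⟩, zero-mode physics).  HONEST FRAMING: fixed-lattice helper estimates; no stub, crux, rung or summit statement is proved here; nothing about infinite
volume, the continuum or the Yang–Mills mass gap.  No `sorry`, no new definition.
References: [cite: ReedSimonIV1978, Thm. XIII.43]; [cite: Luscher1983, §2].
-/

set_option autoImplicit false

noncomputable section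

open MeasureTheory Filter Topology Real
open Literature.MathematicalPhysics.QuantumFieldTheory (GaugeConfig Site Edge)
open Literature.MathematicalPhysics.QuantumLattice (fundamentalRep_apply secondCountableTopology_su2)

namespace Summit.QuantumFields.YangMills.Theorems.TransportFieldFano

open Summit.QuantumFields.YangMills.Theorems.FemtoTransferGap

variable {L : ℕ} [NeZero L]

/-- ★ **Torelon mean floor, direction `0`, site-averaged letter**: `e^{−15}/β² ≤ ⟨F₀Ω, Ω⟩` for `β ≥ 1`, every `L` and every `l2`-normalised physical
`Ω` with `K_βΩ = λ₀Ω`. [cite: ReedSimonIV1978, Thm. XIII.43] [cite: Luscher1983, §2] -/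
theorem torelonMean_zero_ge {β : ℝ} (hβ : 1 ≤ β) {Ω : GaugeConfig 3 L SU2 → ℝ} (hΩ : IsPhys Ω) (hn : l2 Ω Ω = 1)
    (heig : transferApply β Ω = topValue su2Rep L β • Ω) :
    Real.exp (-15) / β ^ 2 ≤
      l2 (fun U => flowLift 0 (fun u : GaugeConfig 3 1 SU2 => 4 - ((su2Rep (u ((0 : Site 3 1), (0 : Fin 3)))).trace.re) ^ 2) U * Ω U) Ω := by
  haveI : SecondCountableTopology SU2 := secondCountableTopology_su2
  set f : GaugeConfig 3 1 SU2 → ℝ := fun u => 4 - ((su2Rep (u ((0 : Site 3 1), (0 : Fin 3)))).trace.re) ^ 2 with hf_def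
  have hfm : Measurable f := by
    have h1 : Continuous fun u : GaugeConfig 3 1 SU2 => su2Rep (u ((0 : Site 3 1), (0 : Fin 3))) :=
      continuous_su2Rep.comp (continuous_apply _)
    exact (continuous_const.sub ((Complex.continuous_re.comp h1.matrix_trace).pow 2)).measurable
  have hfb : ∀ u, |f u| ≤ 4 := fun u => by
    rw [hf_def]; dsimp only
    have h1 := re_trace_le_two (u ((0 : Site 3 1), (0 : Fin 3)))
    have h2 := neg_two_le_re_trace (u ((0 : Site 3 1), (0 : Fin 3)))
    rw [fundamentalRep_apply, abs_le]
    constructor <;> nlinarith [sq_nonneg (((u ((0 : Site 3 1), (0 : Fin 3)) : SU2) : Matrix (Fin 2) (Fin 2) ℂ).trace.re)]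
  rw [← l2_flowLiftAt_mul_vacuum_eq_flowLift β hΩ heig hfm hfb (0 : Site 3 L)]
  have h1 : l2 (fun U => flowLiftAt (0 : Site 3 L) 0 f U * Ω U) Ω =
      ∫ U, flowLiftAt (0 : Site 3 L) 0 f U * Ω U ^ 2 ∂configMeasure SU2 L := by
    unfold l2; exact integral_congr_ae (ae_of_all _ fun U => by dsimp only; ring)
  rw [h1]
  exact torelonDev_vacuum_mean_ge hβ hΩ hn heig (0 : Site 3 L)

/-- `0 < ⟨F₀Ω, Ω⟩` (`β ≥ 1`). [cite: ReedSimonIV1978, Thm. XIII.43] -/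
theorem torelonMean_zero_pos {β : ℝ} (hβ : 1 ≤ β) {Ω : GaugeConfig 3 L SU2 → ℝ} (hΩ : IsPhys Ω) (hn : l2 Ω Ω = 1)
    (heig : transferApply β Ω = topValue su2Rep L β • Ω) :
    0 < l2 (fun U => flowLift 0 (fun u : GaugeConfig 3 1 SU2 => 4 - ((su2Rep (u ((0 : Site 3 1), (0 : Fin 3)))).trace.re) ^ 2) U * Ω U) Ω :=
  lt_of_lt_of_le (by have : 0 < β := by linarith
                     positivity) (torelonMean_zero_ge hβ hΩ hn heig)

/-- ★ **Torelon mean floor, direction `1`**: `e^{−15}/β² ≤ ⟨F₁Ω, Ω⟩` (axis symmetry ✓`CovariantCurrentDoor.stub_directionSymmetry`).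
[cite: ReedSimonIV1978, Thm. XIII.43] [cite: Luscher1983, §2] -/
theorem torelonMean_one_ge {β : ℝ} (hβ : 1 ≤ β) {Ω : GaugeConfig 3 L SU2 → ℝ} (hΩ : IsPhys Ω) (hn : l2 Ω Ω = 1)
    (heig : transferApply β Ω = topValue su2Rep L β • Ω) :
    Real.exp (-15) / β ^ 2 ≤
      l2 (fun U => flowLift 0 (fun u : GaugeConfig 3 1 SU2 => 4 - ((su2Rep (u ((0 : Site 3 1), (1 : Fin 3)))).trace.re) ^ 2) U * Ω U) Ω := by
  have hsymm := CovariantCurrentDoor.stub_directionSymmetry β (by linarith) L Ω hΩ hn heig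
  dsimp only at hsymm
  rw [← hsymm]
  exact torelonMean_zero_ge hβ hΩ hn heig

/-- `0 < ⟨F₁Ω, Ω⟩` (`β ≥ 1`) — the positivity conjunct of the registered stub `stub_crossCoherenceFloor` of ⟨stmt-QuantumFields-23380⟩.
[cite: ReedSimonIV1978, Thm. XIII.43] -/
theorem torelonMean_one_pos {β : ℝ} (hβ : 1 ≤ β) {Ω : GaugeConfig 3 L SU2 → ℝ} (hΩ : IsPhys Ω) (hn : l2 Ω Ω = 1)
    (heig : transferApply β Ω = topValue su2Rep L β • Ω) :
    0 < l2 (fun U => flowLift 0 (fun u : GaugeConfig 3 1 SU2 => 4 - ((su2Rep (u ((0 : Site 3 1), (1 : Fin 3)))).trace.re) ^ 2) U * Ω U) Ω :=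
  lt_of_lt_of_le (by have : 0 < β := by linarith
                     positivity) (torelonMean_one_ge hβ hΩ hn heig)

end Summit.QuantumFields.YangMills.Theorems.TransportFieldFano

end
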